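import Summits.QuantumFields.YangMills.Theorems.FluctuationComparisonRegPrIntLOrganTangentFibredChartFromHeight
import HarnessLib

/-!
# `FluctuationComparisonRegPrIntLOrganTangentFibredChartCompose` — (L14) «CHARTS COMPOSE»: the composite of two fibred charts is a fibred chart of the composite
# average (generic measure theory), and the TWO-STEP chart of `descend F ℰp j ∘ descend F ℰp (j+1)` from a height, AS DATA

Cell `ym3-torus` (rung R3 = continuum `SU(2)` Yang–Mills on T³ — NOT d = 4, NOT infinite volume, NOT a mass gap, NOT Clay), width seat `ym-ust-20520-w5` (gen 22),
pen (L14) (offered 2026-08-30 22:42Z to LEAD-20520 w3 g23, first refusal).  `--kind proof --supports stmt-QuantumFields-20520 --as helper`, count-neutral, definition-free,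
default heartbeats; THEOREMS ONLY; nothing printed is asserted.

WHY.  LEAD's erratum (STATUS 2026-08-30 20:46Z; census v2.4 §5c; TYPING-QUEUE TQ-4): the m-step (A)-package for the composite average `D_m` of the v18 O1ᵘ rows does
NOT compose at the package level — it is built at the CHART level: «fresh private coordinates per height, Jacobians multiply, `hmap` by Fubini, (C1′)(C2) per
level, (C3) from the iterated small lift».  ✓(L12a)(L12b) `…FibredChartData` ∕ `…FibredChartFromHeight` export the one-step chart with `havgΦ` EVERYWHERE and `hmap`
over EVERY measurable base set — exactly the two upgrades that make charts compose.  This file is the composition law itself.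

§1 ★★ `hmap_comp` — GENERIC (any measurable spaces, s-finite measures): fibred charts `(Φ₁, J₁)` of `A₁ : X₁ → X₀` (fibre `(Z₁, τ₁)`, fine set `S₁`, `hmap₁` over every
measurable base set) and `(Φ₂, J₂)` of `A₂ : X₂ → X₁` (fibre `(Z₂, τ₂)`, fine set `S₂`, `hmap₂` likewise) ⟹ the COMPOSITE `Φ (x, (z₁, z₂)) := Φ₂ (Φ₁ (x, z₁), z₂)`,
`J (x, (z₁, z₂)) := J₁ (x, z₁) · J₂ (Φ₁ (x, z₁), z₂)` satisfies `hmap` for `A₁ ∘ A₂` with fibre `(Z₁ × Z₂, τ₁ ⊗ τ₂)` and fine set `A₂ ⁻¹' S₁ ∩ S₂`, over every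
measurable base set («Jacobians multiply, `hmap` by Fubini»: `Measure.prod_withDensity_left`, `Measure.map_prod_map`, `Measure.prodAssoc_prod`, `withDensity_mul`,
lit ✓`T4TriangularFibredChart.map_withDensity_comp_eq`); `havgΦ_comp`, `measurable_comp_chart`, `measurable_comp_jacobian`, the (C2) product bound.
§2 ★★★ `exists_height_fibredChart_two` — the T³ instance at consecutive heights: from ✓`exists_height_fibredChart` at `j` and `j+1`, for every family from a height,
the two-step chart of `descend F ℰp j ∘ descend F ℰp (j+1)` AS DATA with `havgΦ` (everywhere), `hmap` (every base set), (C2), and (C3) the composite mass of the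
`24∕25·θ_{j+2}`-window over every `θ_j`-window datum (the ITERATED small lift ✓(β′) + `hsol` at both levels put the pair of lifts in the composite good set,
which is open by the JOINT openness∕continuity exported by ✓(L12a), and the Jacobian is positive there).
NOT HERE (design point, LEAD's): the composite (C1′) — it is not a composition of the one-step (C1′) letters (the level-`(j+1)` margin wants `Φ₁ (V, U₁)` to be
`cW·θ_{j+1}`-small, which the support of a `θ_{j+2}`-window test function does not provide); window nesting ∕ intermediate cutoffs are the v18 `D_m` text's business.
[cite: Balaban1987RG1, (0.4) p.253, (0.11) p.253, (2.4) p.266 and (2.10) p.267; Balaban1985Averaging, (10)-(13) p.19]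

HONEST: measure-theoretic plumbing + a composition of landed kernel facts; nothing of Bałaban's RG estimates is asserted or proved; O1 ∕ LIN∘ ∕ JVAR∘ ∕ UNIQ-MAX∘ ∕
crux 20520 `FluctuationComparisonRegPrIntL` ∕ `YM3TorusSU2` NOT proved; registry `Lines/semiclassical_s2beta.lean` v11.4 (★★OWNER RULING №36) untouched; rung R3 = SU(2) YM₃
on T³ — NOT d = 4, NOT infinite volume, NOT a mass gap, NOT Clay; the Yang–Mills mass gap is NOT proved by any of this.
-/

set_option autoImplicit false

noncomputable section

namespace Summit.QuantumFields.YangMills.Theorems.FluctuationComparisonRegPrIntLOrganTangentFibredChartCompose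

open MeasureTheory ProbabilityTheory Filter Topology Set Function
open scoped ENNReal NNReal

/-! ## §1 Charts compose (generic) -/

section Pure

variable {X₀ X₁ X₂ Z₁ Z₂ : Type*}

/-- `havgΦ` composes: the composite chart lies over the coarse variable for `A₁ ∘ A₂`. [folklore] -/
theorem havgΦ_comp {A₁ : X₁ → X₀} {A₂ : X₂ → X₁} {Φ₁ : X₀ × Z₁ → X₁} {Φ₂ : X₁ × Z₂ → X₂}
    (h₁ : ∀ x z, A₁ (Φ₁ (x, z)) = x) (h₂ : ∀ y z, A₂ (Φ₂ (y, z)) = y) :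
    ∀ x (z : Z₁ × Z₂), A₁ (A₂ (Φ₂ (Φ₁ (x, z.1), z.2))) = x := fun x z => by
  rw [h₂, h₁]

/-- The (C2) bounds multiply. [folklore] -/
theorem jacobian_comp_le {Φ₁ : X₀ × Z₁ → X₁} {J₁ : X₀ × Z₁ → ℝ≥0} {J₂ : X₁ × Z₂ → ℝ≥0} {B₁ B₂ : ℝ}
    (h₁ : ∀ x z, (J₁ (x, z) : ℝ) ≤ B₁) (h₂ : ∀ y z, (J₂ (y, z) : ℝ) ≤ B₂) :
    ∀ x (z : Z₁ × Z₂), ((J₁ (x, z.1) * J₂ (Φ₁ (x, z.1), z.2) : ℝ≥0) : ℝ) ≤ B₁ * B₂ := fun x z => by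
  rw [NNReal.coe_mul]
  exact mul_le_mul (h₁ x z.1) (h₂ (Φ₁ (x, z.1)) z.2) (J₂ (Φ₁ (x, z.1), z.2)).coe_nonneg ((J₁ (x, z.1)).coe_nonneg.trans (h₁ x z.1))

/-- A resampled configuration whose private coordinates are the original ones IS the original configuration. [folklore] -/
theorem extend_eq_self_of {ι κ G : Type*} {β : κ → ι} (hβ : Function.Injective β) {g : κ → G} {U : ι → G}
    (h : ∀ c, g c = U (β c)) : Function.extend β g U = U := by
  funext b
  by_cases hb : ∃ c, β c = b
  · obtain ⟨c, rfl⟩ := hb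
    rw [hβ.extend_apply]
    exact h c
  · exact Function.extend_apply' _ _ _ hb

end Pure

section Generic

variable {X₀ X₁ X₂ Z₁ Z₂ : Type*} [MeasurableSpace X₀] [MeasurableSpace X₁] [MeasurableSpace X₂] [MeasurableSpace Z₁] [MeasurableSpace Z₂]

/-- The composite chart is measurable. [folklore] -/
theorem measurable_comp_chart {Φ₁ : X₀ × Z₁ → X₁} {Φ₂ : X₁ × Z₂ → X₂} (hΦ₁ : Measurable Φ₁) (hΦ₂ : Measurable Φ₂) :
    Measurable fun p : X₀ × (Z₁ × Z₂) => Φ₂ (Φ₁ (p.1, p.2.1), p.2.2) :=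
  hΦ₂.comp ((hΦ₁.comp (measurable_fst.prodMk (measurable_fst.comp measurable_snd))).prodMk (measurable_snd.comp measurable_snd))

/-- The composite Jacobian is measurable. [folklore] -/
theorem measurable_comp_jacobian {Φ₁ : X₀ × Z₁ → X₁} {J₁ : X₀ × Z₁ → ℝ≥0} {J₂ : X₁ × Z₂ → ℝ≥0}
    (hΦ₁ : Measurable Φ₁) (hJ₁ : Measurable J₁) (hJ₂ : Measurable J₂) :
    Measurable fun p : X₀ × (Z₁ × Z₂) => J₁ (p.1, p.2.1) * J₂ (Φ₁ (p.1, p.2.1), p.2.2) :=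
  (hJ₁.comp (measurable_fst.prodMk (measurable_fst.comp measurable_snd))).mul
    (hJ₂.comp ((hΦ₁.comp (measurable_fst.prodMk (measurable_fst.comp measurable_snd))).prodMk (measurable_snd.comp measurable_snd)))

/-- ★★ **CHARTS COMPOSE — `hmap` BY FUBINI, JACOBIANS MULTIPLY.**  If `μ₁⌊(A₁⁻¹ A ∩ S₁) = Φ₁_*((μ₀⌊A ⊗ τ₁) · J₁)` for every measurable `A ⊆ X₀` and
`μ₂⌊(A₂⁻¹ B ∩ S₂) = Φ₂_*((μ₁⌊B ⊗ τ₂) · J₂)` for every measurable `B ⊆ X₁`, then for every measurable `A ⊆ X₀`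
`μ₂⌊((A₁ ∘ A₂)⁻¹ A ∩ (A₂⁻¹ S₁ ∩ S₂)) = Φ_*((μ₀⌊A ⊗ (τ₁ ⊗ τ₂)) · J)` with `Φ (x, (z₁, z₂)) := Φ₂ (Φ₁ (x, z₁), z₂)` and
`J (x, (z₁, z₂)) := J₁ (x, z₁) · J₂ (Φ₁ (x, z₁), z₂)`. [cite: Balaban1987RG1, (0.11) p.253 and (2.10) p.267 (bookkeeping: iterated change of variables)] -/
theorem hmap_comp
    (μ₀ : Measure X₀) (μ₁ : Measure X₁) (μ₂ : Measure X₂) (τ₁ : Measure Z₁) (τ₂ : Measure Z₂)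
    [SFinite μ₀] [SFinite τ₁] [SFinite τ₂]
    {A₁ : X₁ → X₀} {A₂ : X₂ → X₁} (hA₁ : Measurable A₁)
    {Φ₁ : X₀ × Z₁ → X₁} {J₁ : X₀ × Z₁ → ℝ≥0} {S₁ : Set X₁} (hΦ₁ : Measurable Φ₁) (hJ₁ : Measurable J₁) (hS₁ : MeasurableSet S₁)
    {Φ₂ : X₁ × Z₂ → X₂} {J₂ : X₁ × Z₂ → ℝ≥0} {S₂ : Set X₂} (hΦ₂ : Measurable Φ₂) (hJ₂ : Measurable J₂)
    (hmap₁ : ∀ A : Set X₀, MeasurableSet A →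
      μ₁.restrict (A₁ ⁻¹' A ∩ S₁) = (((μ₀.restrict A).prod τ₁).withDensity (fun p => (J₁ p : ℝ≥0∞))).map Φ₁)
    (hmap₂ : ∀ B : Set X₁, MeasurableSet B →
      μ₂.restrict (A₂ ⁻¹' B ∩ S₂) = (((μ₁.restrict B).prod τ₂).withDensity (fun p => (J₂ p : ℝ≥0∞))).map Φ₂) :
    ∀ A : Set X₀, MeasurableSet A →
      μ₂.restrict ((A₁ ∘ A₂) ⁻¹' A ∩ (A₂ ⁻¹' S₁ ∩ S₂)) =
        (((μ₀.restrict A).prod (τ₁.prod τ₂)).withDensity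
            (fun p => ((J₁ (p.1, p.2.1) * J₂ (Φ₁ (p.1, p.2.1), p.2.2) : ℝ≥0) : ℝ≥0∞))).map
          (fun p : X₀ × (Z₁ × Z₂) => Φ₂ (Φ₁ (p.1, p.2.1), p.2.2)) := by
  intro A hA
  -- the intermediate base set
  set B : Set X₁ := A₁ ⁻¹' A ∩ S₁ with hB
  have hBm : MeasurableSet B := (hA₁ hA).inter hS₁
  have hset : (A₁ ∘ A₂) ⁻¹' A ∩ (A₂ ⁻¹' S₁ ∩ S₂) = A₂ ⁻¹' B ∩ S₂ := by
    ext x; simp only [hB, Set.mem_inter_iff, Set.mem_preimage, Function.comp_apply]; tauto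
  rw [hset, hmap₂ B hBm, hmap₁ A hA]
  -- names
  set ν : Measure (X₀ × Z₁) := (μ₀.restrict A).prod τ₁ with hν
  set g : X₀ × Z₁ → ℝ≥0∞ := fun p => (J₁ p : ℝ≥0∞) with hg
  have hgm : Measurable g := measurable_coe_nnreal_ennreal.comp hJ₁
  have hJ₂m : Measurable fun p : X₁ × Z₂ => (J₂ p : ℝ≥0∞) := measurable_coe_nnreal_ennreal.comp hJ₂
  set G : (X₀ × Z₁) × Z₂ → X₁ × Z₂ := Prod.map Φ₁ id with hG
  have hGm : Measurable G := hΦ₁.prodMap measurable_id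
  have hg1 : Measurable fun q : (X₀ × Z₁) × Z₂ => g q.1 := hgm.comp measurable_fst
  have hJG : Measurable fun q : (X₀ × Z₁) × Z₂ => (J₂ (G q) : ℝ≥0∞) := hJ₂m.comp hGm
  have hF : Measurable fun q : (X₀ × Z₁) × Z₂ => g q.1 * (J₂ (G q) : ℝ≥0∞) := hg1.mul hJG
  -- Step 1: the product of the pushed-forward weighted measure with `τ₂` is a push-forward of a weighted product (Fubini)
  have h1 : ((ν.withDensity g).map Φ₁).prod τ₂ = ((ν.prod τ₂).withDensity fun q => g q.1).map G := by
    conv_lhs => rw [← Measure.map_id (μ := τ₂)]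
    rw [Measure.map_prod_map _ _ hΦ₁ measurable_id, prod_withDensity_left hgm]
  -- Step 2: weight by `J₂` after the push-forward = weight by `J₂ ∘ G` before
  have h2 : (((ν.prod τ₂).withDensity fun q => g q.1).map G).withDensity (fun p => (J₂ p : ℝ≥0∞)) =
      (((ν.prod τ₂).withDensity fun q => g q.1).withDensity fun q => (J₂ (G q) : ℝ≥0∞)).map G :=
    (Literature.MathematicalPhysics.QuantumFieldTheory.Balaban1983to89.T4TriangularFibredChart.map_withDensity_comp_eq _ hGm hJ₂m).symm
  -- Step 3: the two weights multiply (Jacobians multiply)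
  have h3 : ((ν.prod τ₂).withDensity fun q => g q.1).withDensity (fun q => (J₂ (G q) : ℝ≥0∞)) =
      (ν.prod τ₂).withDensity fun q => g q.1 * (J₂ (G q) : ℝ≥0∞) := by
    rw [show (fun q : (X₀ × Z₁) × Z₂ => g q.1 * (J₂ (G q) : ℝ≥0∞)) =
        (fun q : (X₀ × Z₁) × Z₂ => g q.1) * (fun q => (J₂ (G q) : ℝ≥0∞)) from rfl, withDensity_mul _ hg1 hJG]
  rw [h1, h2, h3, Measure.map_map hΦ₂ hGm]
  -- Step 4: re-associate the fibre `(X₀ × Z₁) × Z₂ ≃ X₀ × (Z₁ × Z₂)`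
  have h4 : ν.prod τ₂ = ((μ₀.restrict A).prod (τ₁.prod τ₂)).map (MeasurableEquiv.prodAssoc (α := X₀) (β := Z₁) (γ := Z₂)).symm := by
    rw [← Measure.prodAssoc_prod, MeasurableEquiv.map_symm_map]
  rw [h4, ← Literature.MathematicalPhysics.QuantumFieldTheory.Balaban1983to89.T4TriangularFibredChart.map_withDensity_comp_eq _
      (MeasurableEquiv.prodAssoc (α := X₀) (β := Z₁) (γ := Z₂)).symm.measurable hF,
    Measure.map_map (hΦ₂.comp hGm) (MeasurableEquiv.prodAssoc (α := X₀) (β := Z₁) (γ := Z₂)).symm.measurable]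
  -- the two sides agree up to unfolding the equivalence and `↑(a * b) = ↑a * ↑b`
  have hfun : (fun x : X₀ × (Z₁ × Z₂) => (fun q : (X₀ × Z₁) × Z₂ => g q.1 * (J₂ (G q) : ℝ≥0∞))
        ((MeasurableEquiv.prodAssoc (α := X₀) (β := Z₁) (γ := Z₂)).symm x)) =
      fun p : X₀ × (Z₁ × Z₂) => ((J₁ (p.1, p.2.1) * J₂ (Φ₁ (p.1, p.2.1), p.2.2) : ℝ≥0) : ℝ≥0∞) := by
    funext p
    rw [ENNReal.coe_mul]
    rfl
  have hmapfun : ((Φ₂ ∘ G) ∘ ⇑(MeasurableEquiv.prodAssoc (α := X₀) (β := Z₁) (γ := Z₂)).symm) =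
      fun p : X₀ × (Z₁ × Z₂) => Φ₂ (Φ₁ (p.1, p.2.1), p.2.2) := by
    funext p
    rfl
  rw [hfun, hmapfun]

end Generic

/-! ## §2 The two-step chart of `descend F ℰp j ∘ descend F ℰp (j+1)` from a height, AS DATA -/

section TwoStep

open Literature.MathematicalPhysics.QuantumFieldTheory.Balaban1983to89
open T3ContinuumYM3Torus T3NestedUnitLaws T3UnitLawDensityEML T3UnitScaleTilt T3LevelShift
open Literature.MathematicalPhysics.QuantumFieldTheory.Balaban1983to89.T3OrbitAverage
open Literature.MathematicalPhysics.QuantumFieldTheory.Balaban1983to89.BlockAveragingHaarAC (centralBond)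
open Summit.QuantumFields.YangMills.Theorems.OrganTangentFibreMeanTools
open Summit.QuantumFields.YangMills.Theorems.OrganTangentTriangularChart (injective_private)
open Summit.QuantumFields.YangMills.Theorems.FluctuationComparisonRegPrIntLOrganTangentFibredChartFromHeight (exists_height_fibredChart)

/-- ★★★ **THE TWO-STEP FIBRED CHART OF `descend F ℰp j ∘ descend F ℰp (j+1)` FROM A HEIGHT, AS DATA.**  For every family `F`, every `0 < γ ≤ 1`, `0 < b₀`,
`0 < p₀` there is a height `jA` such that at every `j ≥ jA` there are measurable fine sets `S₁ ⊆ GaugeField_{j+1}`, `S₂ ⊆ GaugeField_{j+2}` containing the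
`24∕25·θ_{j+1}`- resp. `24∕25·θ_{j+2}`-windows, a measurable chart `Φ : GaugeField_j × (GaugeField_{j+1} × GaugeField_{j+2}) → GaugeField_{j+2}` with a measurable
Jacobian `J ≥ 0`, bounded by a constant, such that `descend_j (descend_{j+1} (Φ (V, z))) = V` for ALL `V, z`; the chart identity
`dU_{j+2}⌊((descend_j ∘ descend_{j+1})⁻¹ A ∩ (descend_{j+1}⁻¹ S₁ ∩ S₂)) = Φ_*((dU_j⌊A ⊗ (dU_{j+1} ⊗ dU_{j+2})) · J)` holds over EVERY measurable base set `A`;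
and (C3) the `24∕25·θ_{j+2}`-window has positive chart mass over every `θ_j`-window datum (the ITERATED small lift).  Proof: ✓`exists_height_fibredChart` at `j` and
`j+1` ∘ §1. [cite: Balaban1987RG1, (0.4) p.253, (0.11) p.253, (0.18) p.255 and (2.10) p.267; Balaban1985Averaging, (10)-(13) p.19] -/
theorem exists_height_fibredChart_two
    (F : T3Family) (γ b₀ p₀ : ℝ) (hγ : 0 < γ) (hγ1 : γ ≤ 1) (hb₀ : 0 < b₀) (hp₀ : 0 < p₀) :
    ∃ jA : ℕ, ∀ (j : ℕ), jA ≤ j →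
      ∃ (S₁ : Set (GaugeField (F.P (j + 1)) 0 ↥(Matrix.specialUnitaryGroup (Fin 2) ℂ)))
        (S₂ : Set (GaugeField (F.P (j + 1 + 1)) 0 ↥(Matrix.specialUnitaryGroup (Fin 2) ℂ)))
        (Φ : GaugeField (F.P j) 0 ↥(Matrix.specialUnitaryGroup (Fin 2) ℂ) ×
            (GaugeField (F.P (j + 1)) 0 ↥(Matrix.specialUnitaryGroup (Fin 2) ℂ) × GaugeField (F.P (j + 1 + 1)) 0 ↥(Matrix.specialUnitaryGroup (Fin 2) ℂ)) →
          GaugeField (F.P (j + 1 + 1)) 0 ↥(Matrix.specialUnitaryGroup (Fin 2) ℂ))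
        (J : GaugeField (F.P j) 0 ↥(Matrix.specialUnitaryGroup (Fin 2) ℂ) ×
            (GaugeField (F.P (j + 1)) 0 ↥(Matrix.specialUnitaryGroup (Fin 2) ℂ) × GaugeField (F.P (j + 1 + 1)) 0 ↥(Matrix.specialUnitaryGroup (Fin 2) ℂ)) → ℝ≥0)
        (B : ℝ),
        MeasurableSet S₁ ∧ MeasurableSet S₂ ∧ Measurable Φ ∧ Measurable J ∧
        (∀ U, PlaqSmall (24 / 25 * θBal F.L γ b₀ p₀ (j + 1)) U → U ∈ S₁) ∧
        (∀ U, PlaqSmall (24 / 25 * θBal F.L γ b₀ p₀ (j + 1 + 1)) U → U ∈ S₂) ∧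
        -- havgΦ (everywhere)
        (∀ V z, descend F ℰp j (descend F ℰp (j + 1) (Φ (V, z))) = V) ∧
        -- hmap (every measurable base set)
        (∀ A : Set (GaugeField (F.P j) 0 ↥(Matrix.specialUnitaryGroup (Fin 2) ℂ)), MeasurableSet A →
          (fieldMeasure (F.P (j + 1 + 1)) 0 ↥(Matrix.specialUnitaryGroup (Fin 2) ℂ)).restrict
              ((descend F ℰp j ∘ descend F ℰp (j + 1)) ⁻¹' A ∩ (descend F ℰp (j + 1) ⁻¹' S₁ ∩ S₂)) =
            ((((fieldMeasure (F.P j) 0 ↥(Matrix.specialUnitaryGroup (Fin 2) ℂ)).restrict A).prod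
                ((fieldMeasure (F.P (j + 1)) 0 ↥(Matrix.specialUnitaryGroup (Fin 2) ℂ)).prod
                  (fieldMeasure (F.P (j + 1 + 1)) 0 ↥(Matrix.specialUnitaryGroup (Fin 2) ℂ)))).withDensity (fun p => (J p : ℝ≥0∞))).map Φ) ∧
        -- (C2)
        (∀ V z, (J (V, z) : ℝ) ≤ B) ∧
        -- (C3) the composite mass of the `24∕25·θ_{j+2}`-window (iterated small lift)
        (∀ V, PlaqSmall (θBal F.L γ b₀ p₀ j) V →
          0 < ∫⁻ z in {z | PlaqSmall (24 / 25 * θBal F.L γ b₀ p₀ (j + 1 + 1)) (Φ (V, z))}, (J (V, z) : ℝ≥0∞)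
            ∂((fieldMeasure (F.P (j + 1)) 0 ↥(Matrix.specialUnitaryGroup (Fin 2) ℂ)).prod
                (fieldMeasure (F.P (j + 1 + 1)) 0 ↥(Matrix.specialUnitaryGroup (Fin 2) ℂ)))) := by
  classical
  obtain ⟨jA, hjA⟩ := exists_height_fibredChart F γ b₀ p₀ hγ hγ1 hb₀ hp₀
  refine ⟨jA, fun j hj => ?_⟩
  -- level `j` and level `j + 1` charts
  obtain ⟨Ω₁, T₁, T₁', θ₁, jac₁, M₁, s₁, Φ₁, J₁, ⟨hΩm₁, -, -, -, -, -, -, -, hT'T₁, -, hΩS₁, -, -, -, -, -, hsol₁, hjne₁⟩, hlift₁, -,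
    hΦm₁, hJm₁, hΦg₁, -, hJg₁, -, hGo₁, hΦc₁, -, havg₁, hmap₁, -, hJB₁, -⟩ := hjA j hj
  obtain ⟨Ω₂, T₂, T₂', θ₂, jac₂, M₂, s₂, Φ₂, J₂, ⟨hΩm₂, -, -, -, -, -, -, -, hT'T₂, -, hΩS₂, -, -, -, -, -, hsol₂, hjne₂⟩, hlift₂, -,
    hΦm₂, hJm₂, hΦg₂, -, hJg₂, -, hGo₂, hΦc₂, -, havg₂, hmap₂, -, hJB₂, -⟩ := hjA (j + 1) (by omega)
  -- standing facts
  haveI : BorelSpace (GaugeField (F.P j) 0 ↥(Matrix.specialUnitaryGroup (Fin 2) ℂ)) := T3OrbitAverage.instBorelSpaceGaugeField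
  haveI : BorelSpace (GaugeField (F.P (j + 1)) 0 ↥(Matrix.specialUnitaryGroup (Fin 2) ℂ)) := T3OrbitAverage.instBorelSpaceGaugeField
  haveI : BorelSpace (GaugeField (F.P (j + 1 + 1)) 0 ↥(Matrix.specialUnitaryGroup (Fin 2) ℂ)) := T3OrbitAverage.instBorelSpaceGaugeField
  haveI : IsProbabilityMeasure (fieldMeasure (F.P j) 0 ↥(Matrix.specialUnitaryGroup (Fin 2) ℂ)) := Missing.isProbabilityMeasure_fieldMeasure _ _
  haveI : IsProbabilityMeasure (fieldMeasure (F.P (j + 1)) 0 ↥(Matrix.specialUnitaryGroup (Fin 2) ℂ)) := Missing.isProbabilityMeasure_fieldMeasure _ _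
  haveI : IsProbabilityMeasure (fieldMeasure (F.P (j + 1 + 1)) 0 ↥(Matrix.specialUnitaryGroup (Fin 2) ℂ)) := Missing.isProbabilityMeasure_fieldMeasure _ _
  haveI : (fieldMeasure (F.P (j + 1)) 0 ↥(Matrix.specialUnitaryGroup (Fin 2) ℂ)).IsOpenPosMeasure :=
    B12ContinuousTransportInvariance.isOpenPosMeasure_fieldMeasure_SU 2 (F.P (j + 1)) 0
  haveI : (fieldMeasure (F.P (j + 1 + 1)) 0 ↥(Matrix.specialUnitaryGroup (Fin 2) ℂ)).IsOpenPosMeasure :=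
    B12ContinuousTransportInvariance.isOpenPosMeasure_fieldMeasure_SU 2 (F.P (j + 1 + 1)) 0
  have hd₁ : Measurable (descend F ℰp j : GaugeField (F.P (j + 1)) 0 ↥(Matrix.specialUnitaryGroup (Fin 2) ℂ) →
      GaugeField (F.P j) 0 ↥(Matrix.specialUnitaryGroup (Fin 2) ℂ)) := T3NestedUnitLaws.measurable_descend F ℰp measurableE_ℰp j
  set β₁ : PBond (F.P j) 0 → PBond (F.P (j + 1)) 0 := fun c => centralBond (bondShift (sitesPerDir_descend F j 0) c) with hβ₁
  set β₂ : PBond (F.P (j + 1)) 0 → PBond (F.P (j + 1 + 1)) 0 := fun c => centralBond (bondShift (sitesPerDir_descend F (j + 1) 0) c) with hβ₂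
  set S₁ : Set (GaugeField (F.P (j + 1)) 0 ↥(Matrix.specialUnitaryGroup (Fin 2) ℂ)) := {U | ∀ c, U (β₁ c) ∈ Ω₁ c U} with hS₁
  set S₂ : Set (GaugeField (F.P (j + 1 + 1)) 0 ↥(Matrix.specialUnitaryGroup (Fin 2) ℂ)) := {U | ∀ c, U (β₂ c) ∈ Ω₂ c U} with hS₂
  have hS₁m : MeasurableSet S₁ := T4TriangularFibredChart.measurableSet_fineDomain (β := β₁) Ω₁ hΩm₁
  have hS₂m : MeasurableSet S₂ := T4TriangularFibredChart.measurableSet_fineDomain (β := β₂) Ω₂ hΩm₂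
  -- positivity of the Jacobians on the good sets
  have hjpos₁ : ∀ c U v, v ∈ T₁ c U → 0 < jac₁ c U v := fun c U v hv => pos_iff_ne_zero.2 (hjne₁ c U v hv)
  have hjpos₂ : ∀ c U v, v ∈ T₂ c U → 0 < jac₂ c U v := fun c U v hv => pos_iff_ne_zero.2 (hjne₂ c U v hv)
  refine ⟨S₁, S₂, fun p => Φ₂ (Φ₁ (p.1, p.2.1), p.2.2), fun p => J₁ (p.1, p.2.1) * J₂ (Φ₁ (p.1, p.2.1), p.2.2),
    (M₁ : ℝ) ^ Fintype.card (PBond (F.P j) 0) * (M₂ : ℝ) ^ Fintype.card (PBond (F.P (j + 1)) 0),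
    hS₁m, hS₂m, measurable_comp_chart hΦm₁ hΦm₂, measurable_comp_jacobian hΦm₁ hJm₁ hJm₂,
    fun U hU c => hΩS₁ U hU c, fun U hU c => hΩS₂ U hU c, havgΦ_comp havg₁ havg₂, ?_, jacobian_comp_le hJB₁ hJB₂, ?_⟩
  · -- hmap for the composite: §1
    exact hmap_comp (fieldMeasure (F.P j) 0 ↥(Matrix.specialUnitaryGroup (Fin 2) ℂ))
      (fieldMeasure (F.P (j + 1)) 0 ↥(Matrix.specialUnitaryGroup (Fin 2) ℂ))
      (fieldMeasure (F.P (j + 1 + 1)) 0 ↥(Matrix.specialUnitaryGroup (Fin 2) ℂ))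
      (fieldMeasure (F.P (j + 1)) 0 ↥(Matrix.specialUnitaryGroup (Fin 2) ℂ))
      (fieldMeasure (F.P (j + 1 + 1)) 0 ↥(Matrix.specialUnitaryGroup (Fin 2) ℂ))
      hd₁ hΦm₁ hJm₁ hS₁m hΦm₂ hJm₂ hmap₁ hmap₂
  · -- (C3): the iterated small lift lies in the composite good set, which is open, and the Jacobian is positive there
    intro V hV
    set θ' : ℝ := θBal F.L γ b₀ p₀ (j + 1) with hθ'
    set θ'' : ℝ := θBal F.L γ b₀ p₀ (j + 1 + 1) with hθ''
    -- the lifts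
    obtain ⟨U₁, hU₁V, hU₁s⟩ := hlift₁ V hV
    have hθ'pos : 0 < θ' := T3MinimiserStabilityReduction.θBal_pos F.hL.2.le hγ hγ1 hb₀ p₀ (j + 1)
    have hU₁W : PlaqSmall θ' U₁ := fun p => (hU₁s p).trans_le (by nlinarith [hθ'pos])
    obtain ⟨U₂, hU₂U₁, hU₂s⟩ := hlift₂ U₁ hU₁W
    -- good-set memberships and the charts at the lifts
    have hG₁ : ∀ c, V c ∈ T₁ c U₁ := fun c => by
      rw [show V c = descend F ℰp j U₁ c by rw [hU₁V]]
      exact subset_closure.trans (hT'T₁ c U₁) (hsol₁ U₁ hU₁s c).1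
    have hΦ₁U₁ : Φ₁ (V, U₁) = U₁ := by
      rw [hΦg₁ V U₁ hG₁]
      refine extend_eq_self_of (injective_private F j) fun c => ?_
      rw [show V c = descend F ℰp j U₁ c by rw [hU₁V]]
      exact (hsol₁ U₁ hU₁s c).2
    have hG₂ : ∀ c, U₁ c ∈ T₂ c U₂ := fun c => by
      rw [show U₁ c = descend F ℰp (j + 1) U₂ c by rw [hU₂U₁]]
      exact subset_closure.trans (hT'T₂ c U₂) (hsol₂ U₂ hU₂s c).1
    have hΦ₂U₂ : Φ₂ (U₁, U₂) = U₂ := by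
      rw [hΦg₂ U₁ U₂ hG₂]
      refine extend_eq_self_of (injective_private F (j + 1)) fun c => ?_
      rw [show U₁ c = descend F ℰp (j + 1) U₂ c by rw [hU₂U₁]]
      exact (hsol₂ U₂ hU₂s c).2
    -- the composite good set in the fibre variables, at the datum `V`
    set G : Set (GaugeField (F.P (j + 1)) 0 ↥(Matrix.specialUnitaryGroup (Fin 2) ℂ) × GaugeField (F.P (j + 1 + 1)) 0 ↥(Matrix.specialUnitaryGroup (Fin 2) ℂ)) :=
      {z | (∀ c, V c ∈ T₁ c z.1) ∧ (∀ c, Φ₁ (V, z.1) c ∈ T₂ c z.2) ∧ PlaqSmall (24 / 25 * θ'') (Φ₂ (Φ₁ (V, z.1), z.2))} with hG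
    -- openness: the first condition is an open slice; on it `z ↦ (Φ₁ (V, z.1), z.2)` is continuous into the open good set of level `j+1`,
    -- on which `Φ₂` is continuous into the open window
    have hO : IsOpen {U : GaugeField (F.P (j + 1 + 1)) 0 ↥(Matrix.specialUnitaryGroup (Fin 2) ℂ) | PlaqSmall (24 / 25 * θ'') U} := by
      have e : {U : GaugeField (F.P (j + 1 + 1)) 0 ↥(Matrix.specialUnitaryGroup (Fin 2) ℂ) | PlaqSmall (24 / 25 * θ'') U} =
          ⋂ p : Plaq (F.P (j + 1 + 1)) 0, {U | dist1 (GaugeField.plaqHol U p) < 24 / 25 * θ''} := by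
        ext U; simp only [PlaqSmall, Set.mem_setOf_eq, Set.mem_iInter]
      rw [e]
      exact isOpen_iInter_of_finite fun p => isOpen_lt (continuous_dist1_plaqHol p) continuous_const
    have hG1open : IsOpen {z : GaugeField (F.P (j + 1)) 0 ↥(Matrix.specialUnitaryGroup (Fin 2) ℂ) ×
        GaugeField (F.P (j + 1 + 1)) 0 ↥(Matrix.specialUnitaryGroup (Fin 2) ℂ) | ∀ c, V c ∈ T₁ c z.1} :=
      hGo₁.preimage (continuous_const.prodMk continuous_fst)
    have hΨc : ContinuousOn (fun z : GaugeField (F.P (j + 1)) 0 ↥(Matrix.specialUnitaryGroup (Fin 2) ℂ) ×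
        GaugeField (F.P (j + 1 + 1)) 0 ↥(Matrix.specialUnitaryGroup (Fin 2) ℂ) => (Φ₁ (V, z.1), z.2))
        {z | ∀ c, V c ∈ T₁ c z.1} :=
      ((hΦc₁.comp (continuous_const.prodMk continuous_fst).continuousOn fun z hz => hz).prodMk continuousOn_snd)
    have hG12open : IsOpen {z : GaugeField (F.P (j + 1)) 0 ↥(Matrix.specialUnitaryGroup (Fin 2) ℂ) ×
        GaugeField (F.P (j + 1 + 1)) 0 ↥(Matrix.specialUnitaryGroup (Fin 2) ℂ) | (∀ c, V c ∈ T₁ c z.1) ∧ (∀ c, Φ₁ (V, z.1) c ∈ T₂ c z.2)} :=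
      hΨc.isOpen_inter_preimage hG1open hGo₂
    have hΧc : ContinuousOn (fun z : GaugeField (F.P (j + 1)) 0 ↥(Matrix.specialUnitaryGroup (Fin 2) ℂ) ×
        GaugeField (F.P (j + 1 + 1)) 0 ↥(Matrix.specialUnitaryGroup (Fin 2) ℂ) => Φ₂ (Φ₁ (V, z.1), z.2))
        {z | (∀ c, V c ∈ T₁ c z.1) ∧ (∀ c, Φ₁ (V, z.1) c ∈ T₂ c z.2)} :=
      hΦc₂.comp (hΨc.mono fun z hz => hz.1) fun z hz => hz.2
    have hGopen : IsOpen G := by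
      have e : G = {z | (∀ c, V c ∈ T₁ c z.1) ∧ (∀ c, Φ₁ (V, z.1) c ∈ T₂ c z.2)} ∩
          (fun z => Φ₂ (Φ₁ (V, z.1), z.2)) ⁻¹' {U | PlaqSmall (24 / 25 * θ'') U} := by
        ext z; simp only [hG, Set.mem_setOf_eq, Set.mem_inter_iff, Set.mem_preimage, and_assoc]
      rw [e]
      exact hΧc.isOpen_inter_preimage hG12open hO
    -- the pair of lifts is in `G`
    have hmemG : (U₁, U₂) ∈ G := by
      refine ⟨hG₁, ?_, ?_⟩
      · intro c; rw [hΦ₁U₁]; exact hG₂ c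
      · show PlaqSmall (24 / 25 * θ'') (Φ₂ (Φ₁ (V, U₁), U₂))
        rw [hΦ₁U₁, hΦ₂U₂]; exact hU₂s
    have hGpos : 0 < ((fieldMeasure (F.P (j + 1)) 0 ↥(Matrix.specialUnitaryGroup (Fin 2) ℂ)).prod
        (fieldMeasure (F.P (j + 1 + 1)) 0 ↥(Matrix.specialUnitaryGroup (Fin 2) ℂ))) G := hGopen.measure_pos _ ⟨(U₁, U₂), hmemG⟩
    -- the Jacobian is positive on `G`
    have hJm : Measurable fun z : GaugeField (F.P (j + 1)) 0 ↥(Matrix.specialUnitaryGroup (Fin 2) ℂ) ×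
        GaugeField (F.P (j + 1 + 1)) 0 ↥(Matrix.specialUnitaryGroup (Fin 2) ℂ) => ((J₁ (V, z.1) * J₂ (Φ₁ (V, z.1), z.2) : ℝ≥0) : ℝ≥0∞) :=
      measurable_coe_nnreal_ennreal.comp ((measurable_comp_jacobian hΦm₁ hJm₁ hJm₂).comp measurable_prodMk_left)
    have hJne : ∀ z ∈ G, ((J₁ (V, z.1) * J₂ (Φ₁ (V, z.1), z.2) : ℝ≥0) : ℝ≥0∞) ≠ 0 := by
      intro z hz
      have h1 : J₁ (V, z.1) ≠ 0 := by
        rw [hJg₁ V z.1 hz.1]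
        exact Finset.prod_ne_zero_iff.2 fun c _ => (hjpos₁ c z.1 (V c) (hz.1 c)).ne'
      have h2 : J₂ (Φ₁ (V, z.1), z.2) ≠ 0 := by
        rw [hJg₂ (Φ₁ (V, z.1)) z.2 hz.2.1]
        exact Finset.prod_ne_zero_iff.2 fun c _ => (hjpos₂ c z.2 (Φ₁ (V, z.1) c) (hz.2.1 c)).ne'
      exact ENNReal.coe_ne_zero.2 (mul_ne_zero h1 h2)
    rw [lintegral_pos_iff_support hJm, Measure.restrict_apply (measurableSet_support hJm)]
    exact hGpos.trans_le (measure_mono fun z hz => Set.mem_inter (Function.mem_support.2 (hJne z hz)) hz.2.2)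

end TwoStep

end Summit.QuantumFields.YangMills.Theorems.FluctuationComparisonRegPrIntLOrganTangentFibredChartCompose

end
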